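import Mathlib
import Literature.Barriers.Parity.LogarithmicAveraging

/-!
# SoloInformedDirichletHyperbola — Dirichlet's hyperbola identity and log-power bookkeeping

Solo unit `solo-Parity-informed` (ideation tier, informed mode), session 17; `PLAN.md` §25.3 (α1), CLAIMS C82.

* `sum_Ioc_mul_eq_hyperbola` — Dirichlet's hyperbola identity for arithmetic functions over a
  commutative ring: for `Y ≤ T`,
  `∑_{n ≤ T} (f*g)(n) = ∑_{m ≤ Y} f(m) G(T/m) + ∑_{n ≤ T/(Y+1)} g(n) (F(T/n) - F(Y))`
  (`F, G` the summatory functions; Mathlib has the one-sided case `sum_Ioc_mul_eq_sum_sum`);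
* `one_sub_log_two_mul_le_log_sqrt` — `(1 - log 2)(1 + log T) ≤ 1 + log ⌊√T⌋`;
* `exists_one_add_log_pow_le_mul_rpow` — `(1 + log t)^B ≤ K_{B,δ} t^δ`;
* `sum_Icc_abs_mul_le`, `logPowBounded_mul` — `∑_{n ≤ N} |(f*g)(n)| ≤ (∑ |f|)(∑ |g|)`, so
  log-power boundedness `∑_{n ≤ N} |f(n)| ≤ K (1 + log N)^κ` is stable under convolution.

These feed `SoloInformedHarmonicDecayConvolution` (log-power decay of `∑_{n ≤ N} (f*g)(n)`).
-/

namespace Summit.Parity.BatemanHorn.Theorems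

open Finset Real ArithmeticFunction
open Literature.Barriers.Parity (Icc_one_eq_Ioc_zero)

section Hyperbola

variable {R : Type*} [CommRing R]

/-- **Dirichlet's hyperbola identity.**  For `Y ≤ T`,
`∑_{n ≤ T} (f*g)(n) = ∑_{m ≤ Y} f(m) ∑_{n ≤ T/m} g(n) + ∑_{n ≤ T/(Y+1)} g(n) (∑_{m ≤ T/n} f(m) - ∑_{m ≤ Y} f(m))`. -/
theorem sum_Ioc_mul_eq_hyperbola (f g : ArithmeticFunction R) {T Y : ℕ} (hY : Y ≤ T) :
    ∑ n ∈ Ioc 0 T, (f * g) n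
      = ∑ m ∈ Ioc 0 Y, f m * ∑ n ∈ Ioc 0 (T / m), g n
        + ∑ n ∈ Ioc 0 (T / (Y + 1)), g n * (∑ m ∈ Ioc 0 (T / n), f m - ∑ m ∈ Ioc 0 Y, f m) := by
  classical
  set f₁ : ArithmeticFunction R := ⟨fun m => if m ≤ Y then f m else 0, by simp⟩ with hf₁
  set f₂ : ArithmeticFunction R := ⟨fun m => if Y < m then f m else 0, by simp⟩ with hf₂
  have hf₁a : ∀ m, f₁ m = if m ≤ Y then f m else 0 := fun m => rfl
  have hf₂a : ∀ m, f₂ m = if Y < m then f m else 0 := fun m => rfl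
  have hf12 : f * g = f₁ * g + f₂ * g := by
    rw [← add_mul]
    congr 1
    ext m
    rw [ArithmeticFunction.add_apply, hf₁a, hf₂a]
    split_ifs with h1 h2 <;> first | (exfalso; omega) | simp
  have h1 : ∑ n ∈ Ioc 0 T, (f₁ * g) n = ∑ m ∈ Ioc 0 Y, f m * ∑ n ∈ Ioc 0 (T / m), g n := by
    rw [sum_Ioc_mul_eq_sum_sum]
    have : ∀ m ∈ Ioc 0 T, f₁ m * ∑ n ∈ Ioc 0 (T / m), g n
        = if m ≤ Y then f m * ∑ n ∈ Ioc 0 (T / m), g n else 0 := by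
      intro m _; rw [hf₁a]; split_ifs <;> simp
    rw [sum_congr rfl this, ← sum_filter]
    congr 1
    ext m; simp only [mem_filter, mem_Ioc]; omega
  have h2 : ∑ n ∈ Ioc 0 T, (f₂ * g) n
      = ∑ n ∈ Ioc 0 (T / (Y + 1)), g n * (∑ m ∈ Ioc 0 (T / n), f m - ∑ m ∈ Ioc 0 Y, f m) := by
    rw [mul_comm, sum_Ioc_mul_eq_sum_sum]
    have hinner : ∀ n : ℕ, ∑ m ∈ Ioc 0 (T / n), f₂ m = ∑ m ∈ Ioc Y (T / n), f m := by
      intro n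
      have : ∀ m ∈ Ioc 0 (T / n), f₂ m = if Y < m then f m else 0 := fun m _ => hf₂a m
      rw [sum_congr rfl this, ← sum_filter]
      congr 1; ext m; simp only [mem_filter, mem_Ioc]; omega
    simp_rw [hinner]
    have hsub : Ioc 0 (T / (Y + 1)) ⊆ Ioc 0 T := by
      intro n hn
      simp only [mem_Ioc] at hn ⊢
      exact ⟨hn.1, hn.2.trans (Nat.div_le_self _ _)⟩
    rw [← sum_subset hsub]
    · refine sum_congr rfl fun n hn => ?_
      simp only [mem_Ioc] at hn
      have hn0 : 0 < n := hn.1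
      have hYn : Y ≤ T / n := by
        have h' : n * (Y + 1) ≤ T := (Nat.le_div_iff_mul_le (Nat.succ_pos Y)).mp hn.2
        have h'' : Y + 1 ≤ T / n := (Nat.le_div_iff_mul_le hn0).mpr (by rwa [mul_comm] at h')
        omega
      rw [← sum_Ioc_consecutive f (Nat.zero_le Y) hYn]
      ring
    · intro n hn hn'
      simp only [mem_Ioc, not_and, not_le] at hn hn'
      have hlt : T / (Y + 1) < n := hn' hn.1
      have hTn : T / n ≤ Y := by
        have h1 : T < n * (Y + 1) := by
          by_contra h
          push Not at h
          exact absurd ((Nat.le_div_iff_mul_le (Nat.succ_pos Y)).mpr h) (not_le.mpr hlt)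
        have h2 : T / n < Y + 1 := (Nat.div_lt_iff_lt_mul hn.1).mpr (by rwa [mul_comm] at h1)
        omega
      rw [Finset.Ioc_eq_empty (by omega), sum_empty, mul_zero]
  rw [hf12]
  simp only [ArithmeticFunction.add_apply, sum_add_distrib]
  rw [h1, h2]

end Hyperbola

/-! ### Two elementary inequalities -/

/-- `0 < 1 - log 2`. -/
theorem one_sub_log_two_pos : 0 < 1 - Real.log 2 := by
  have := Real.log_two_lt_d9; norm_num at this ⊢; linarith

/-- `(1 - log 2)(1 + log T) ≤ 1 + log ⌊√T⌋` for `T ≥ 1`. -/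
theorem one_sub_log_two_mul_le_log_sqrt {T : ℕ} (hT : 1 ≤ T) :
    (1 - Real.log 2) * (1 + Real.log T) ≤ 1 + Real.log (Nat.sqrt T) := by
  set Y := Nat.sqrt T with hY
  have hY1 : 1 ≤ Y := Nat.sqrt_pos.mpr hT
  have hT4 : (T : ℝ) ≤ 4 * (Y : ℝ) ^ 2 := by
    have h : T < (Y + 1) * (Y + 1) := Nat.lt_succ_sqrt T
    have h' : (Y + 1) * (Y + 1) ≤ 4 * (Y * Y) := by nlinarith
    have h'' : T ≤ 4 * (Y * Y) := by omega
    have : (T : ℝ) ≤ 4 * ((Y : ℝ) * Y) := by exact_mod_cast h''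
    simpa [sq] using this
  have hT0 : (0 : ℝ) < T := by exact_mod_cast hT
  have hY0 : (0 : ℝ) < Y := by exact_mod_cast hY1
  have hlogT : Real.log T ≤ 2 * Real.log 2 + 2 * Real.log Y := by
    calc Real.log T ≤ Real.log (4 * (Y : ℝ) ^ 2) := Real.log_le_log hT0 hT4
      _ = Real.log ((2 : ℝ) ^ 2) + Real.log ((Y : ℝ) ^ 2) := by
          rw [Real.log_mul (by norm_num) (by positivity)]; norm_num
      _ = 2 * Real.log 2 + 2 * Real.log Y := by rw [Real.log_pow, Real.log_pow]; push_cast; ring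
  have hlog2 : (1 : ℝ) / 2 < Real.log 2 := by
    have := Real.log_two_gt_d9; norm_num at this ⊢; linarith
  have hlogT0 : 0 ≤ Real.log (T : ℝ) := Real.log_natCast_nonneg T
  nlinarith [mul_nonneg (sub_nonneg.mpr hlog2.le) hlogT0]

/-- `(1 + log t)^B ≤ K t^δ` for `t ≥ 1`. -/
theorem exists_one_add_log_pow_le_mul_rpow {δ : ℝ} (hδ : 0 < δ) (B : ℕ) :
    ∃ K : ℝ, 0 < K ∧ ∀ t : ℝ, 1 ≤ t → (1 + Real.log t) ^ B ≤ K * t ^ δ := by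
  rcases Nat.eq_zero_or_pos B with hB | hB
  · refine ⟨1, one_pos, fun t ht => ?_⟩
    rw [hB, pow_zero, one_mul]
    exact Real.one_le_rpow ht hδ.le
  · have hB0 : (0 : ℝ) < B := by exact_mod_cast hB
    set ε : ℝ := δ / B with hε
    have hε0 : 0 < ε := div_pos hδ hB0
    refine ⟨(1 + 1 / ε) ^ B, by positivity, fun t ht => ?_⟩
    have ht0 : 0 ≤ t := by linarith
    have h1 : Real.log t ≤ t ^ ε / ε := Real.log_le_rpow_div ht0 hε0
    have h2 : 1 ≤ t ^ ε := Real.one_le_rpow ht hε0.le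
    have h3 : 1 + Real.log t ≤ (1 + 1 / ε) * t ^ ε := by
      rw [add_mul, one_mul, one_div, ← div_eq_inv_mul]; linarith
    have h4 : 0 ≤ 1 + Real.log t := by linarith [Real.log_nonneg ht]
    calc (1 + Real.log t) ^ B ≤ ((1 + 1 / ε) * t ^ ε) ^ B := pow_le_pow_left₀ h4 h3 B
      _ = (1 + 1 / ε) ^ B * t ^ δ := by
          rw [mul_pow, ← Real.rpow_mul_natCast ht0, hε, div_mul_cancel₀ δ hB0.ne']

/-! ### Nonnegativity of the constants -/

/-- A decay constant is nonnegative. -/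
theorem nonneg_of_logPowDecay {h : ℕ → ℝ} {C : ℝ} {B : ℕ}
    (hC : ∀ N : ℕ, 1 ≤ N → |∑ n ∈ Icc 1 N, h n| ≤ C / (1 + Real.log N) ^ B) : 0 ≤ C := by
  have := hC 1 le_rfl
  simp only [Icc_self, sum_singleton, Nat.cast_one, Real.log_one, add_zero, one_pow, div_one] at this
  exact (abs_nonneg _).trans this

/-- A log-power boundedness constant is nonnegative. -/
theorem nonneg_of_logPowBounded {h : ℕ → ℝ} {K : ℝ} {κ : ℕ}
    (hK : ∀ N : ℕ, 1 ≤ N → ∑ n ∈ Icc 1 N, |h n| ≤ K * (1 + Real.log N) ^ κ) : 0 ≤ K := by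
  have := hK 1 le_rfl
  simp only [Icc_self, sum_singleton, Nat.cast_one, Real.log_one, add_zero, one_pow, mul_one] at this
  exact (abs_nonneg _).trans this

/-! ### Log-power boundedness of convolutions -/

/-- `∑_{n ≤ N} |(f*g)(n)| ≤ (∑_{n ≤ N} |f(n)|)(∑_{n ≤ N} |g(n)|)`. -/
theorem sum_Icc_abs_mul_le (f g : ArithmeticFunction ℝ) (N : ℕ) :
    ∑ n ∈ Icc 1 N, |(f * g) n| ≤ (∑ n ∈ Icc 1 N, |f n|) * ∑ n ∈ Icc 1 N, |g n| := by
  classical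
  set F : ArithmeticFunction ℝ := ⟨fun n => |f n|, by simp⟩ with hF
  set G : ArithmeticFunction ℝ := ⟨fun n => |g n|, by simp⟩ with hG
  have hFa : ∀ n, F n = |f n| := fun n => rfl
  have hGa : ∀ n, G n = |g n| := fun n => rfl
  have h1 : ∀ n, |(f * g) n| ≤ (F * G) n := by
    intro n
    rw [mul_apply, mul_apply]
    refine (abs_sum_le_sum_abs _ _).trans (le_of_eq (sum_congr rfl fun x _ => ?_))
    rw [abs_mul, hFa, hGa]
  rw [Icc_one_eq_Ioc_zero]
  calc ∑ n ∈ Ioc 0 N, |(f * g) n| ≤ ∑ n ∈ Ioc 0 N, (F * G) n := sum_le_sum fun n _ => h1 n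
    _ = ∑ n ∈ Ioc 0 N, F n * ∑ m ∈ Ioc 0 (N / n), G m := sum_Ioc_mul_eq_sum_sum F G N
    _ ≤ ∑ n ∈ Ioc 0 N, F n * ∑ m ∈ Ioc 0 N, G m := by
        refine sum_le_sum fun n hn => mul_le_mul_of_nonneg_left ?_ (by rw [hFa]; exact abs_nonneg _)
        refine sum_le_sum_of_subset_of_nonneg (fun m hm => ?_) fun m _ _ => by rw [hGa]; exact abs_nonneg _
        simp only [mem_Ioc] at hm ⊢
        exact ⟨hm.1, hm.2.trans (Nat.div_le_self _ _)⟩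
    _ = (∑ n ∈ Ioc 0 N, |f n|) * ∑ n ∈ Ioc 0 N, |g n| := by
        rw [sum_mul]
        simp only [hFa, hGa]

/-- **Log-power boundedness is stable under convolution.** -/
theorem logPowBounded_mul {f g : ArithmeticFunction ℝ}
    (hf' : ∃ (K : ℝ) (κ : ℕ), ∀ N : ℕ, 1 ≤ N → ∑ n ∈ Icc 1 N, |f n| ≤ K * (1 + Real.log N) ^ κ)
    (hg' : ∃ (K : ℝ) (κ : ℕ), ∀ N : ℕ, 1 ≤ N → ∑ n ∈ Icc 1 N, |g n| ≤ K * (1 + Real.log N) ^ κ) :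
    ∃ (K : ℝ) (κ : ℕ), ∀ N : ℕ, 1 ≤ N → ∑ n ∈ Icc 1 N, |(f * g) n| ≤ K * (1 + Real.log N) ^ κ := by
  obtain ⟨Kf, κf, hKf⟩ := hf'
  obtain ⟨Kg, κg, hKg⟩ := hg'
  have hKf_nn := nonneg_of_logPowBounded hKf
  refine ⟨Kf * Kg, κf + κg, fun N hN => (sum_Icc_abs_mul_le f g N).trans ?_⟩
  have hL : 0 ≤ 1 + Real.log (N : ℝ) := by linarith [Real.log_natCast_nonneg N]
  calc (∑ n ∈ Icc 1 N, |f n|) * ∑ n ∈ Icc 1 N, |g n|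
      ≤ Kf * (1 + Real.log N) ^ κf * (Kg * (1 + Real.log N) ^ κg) :=
        mul_le_mul (hKf N hN) (hKg N hN) (sum_nonneg fun _ _ => abs_nonneg _) (by positivity)
    _ = Kf * Kg * (1 + Real.log N) ^ (κf + κg) := by rw [pow_add]; ring

end Summit.Parity.BatemanHorn.Theorems
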